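import Literature.Barriers.HodgeConjecture.ConjugateVarietiesProofs
import Literature.Barriers.HodgeConjecture.ConjugateVarietiesSerreProofs
import Literature.Barriers.HodgeConjecture.ConjugateVarietiesSerreTopologyProofs
import HarnessLib

/-!
# Serre 1964: the barrier fact from its geometric half (assembly, proved)

Companion to `ConjugateVarieties.lean` (barrier fact `Serre1964_conjugateVarieties_notHomeomorphic`),
`ConjugateVarietiesProofs.lean` (Serre's printed number-field / `π₁` form ⇒ the vendored `Aut(ℂ)`
form) and `ConjugateVarietiesSerreProofs.lean` (the ALGEBRAIC half of Serre's proof: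
`Serre1964.isEmpty_mulEquiv_numberField`).  Proofs only; no definitions, no named facts.

This file assembles the two: `serre1964_of_geometricHalf` PROVES
`Serre1964_conjugateVarieties_notHomeomorphic` from exactly the GEOMETRIC half of Serre's note
(C. R. Acad. Sci. Paris 258 (1964) 4194–4196 = *Œuvres* II no. 63, nos. 1–2), stated as
hypotheses on the fundamental groups of the complex points of a smooth projective variety `V`
over a number field `K` under two embeddings `φ, ψ : K → ℂ`:

* (no. 2, "le groupe `π₁(V_φ)` s'identifie au produit semi-direct de `G` par `π₁(A_φ)`", with
  no. 1, Lemme 2, "Le premier est libre") at every base point `x`, `π₁(V_φ(ℂ), x)` contains a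
  normal subgroup of index `p` identified with `(𝓞 ℚ(ζ_p), +)` (`π₁(A_φ) ≅ S` free of rank one),
  on which some element acts as multiplication by `ζ_p`;
* (same, with "le second ne l'est pas") at every base point `y`, `π₁(V_ψ(ℂ), y)` contains a normal
  subgroup of index `p` identified with `(𝔟·𝓞 ℚ(ζ_p), +)` for a NON-principal ideal `𝔟` of the
  ring of integers of a subfield `k ⊆ ℚ(ζ_p)` with `([ℚ(ζ_p) : k], h_k) = 1` (Serre:
  `k = ℚ(√-p)`, `𝔟 ∈ e_ψ ≠ 1`, `(h, p - 1) = 1`), an element acting as multiplication by `ζ_p`;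
* `V_φ(ℂ) ≠ ∅`.

Given these, `π₁(V_φ(ℂ), x) ≄ π₁(V_ψ(ℂ), y)` for all `x, y` (`isEmpty_mulEquiv_numberField`), so
`V_φ(ℂ)`, `V_ψ(ℂ)` are not homeomorphic and the `Aut(ℂ)` form follows
(`serre1964_of_numberField_fundamentalGroup_form`).  What is NOT here (and not in the tree): the
construction of Serre's `V = (Y × E^{(p-1)/2})/(ℤ/p)` over the Hilbert class field of `ℚ(√-p)`
and the computation of these fundamental groups (uniformisation of CM abelian varieties, the main
theorem of complex multiplication, free quotients, Lefschetz), i.e. the discharge of the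
hypotheses `hφ`, `hψ` below.

## From topological models of `V_φ(ℂ)`, `V_ψ(ℂ)` (added 2026-08-16)

`serre1964_of_torusModels`: with `ConjugateVarietiesSerreTopologyProofs.lean` (the TOPOLOGICAL
half: the orbit spaces `(Y × V/Λ)/G` of Serre's shape are not homeomorphic when the lattices are
`𝓞` resp. `𝔟𝓞` and a generator acts as `ζ_p`), the fact follows as soon as the complex points
`V_φ(ℂ)`, `V_ψ(ℂ)` of a smooth projective `V` over a number field are HOMEOMORPHIC to two such
models ("Nous prendrons comme variété `V` le quotient de `Y × A` par `G`" read on complex points: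
`V_φ(ℂ) = (Y(ℂ) × A_φ(ℂ))/G` with `A_φ(ℂ) = ℂ^g/π₁(A_φ)`, `π₁(A_φ) ≅ S`, `π₁(A_ψ) ≅ e_ψ S`).
This isolates what is left as pure algebraic geometry / analytic uniformisation.

## References

* [Serre1964Conjugate] J.-P. Serre, C. R. Acad. Sci. Paris 258 (1964) 4194–4196, nos. 1–2,
  Lemme 2, Théorème p. 4196.
-/

noncomputable section

namespace Literature.Barriers.HodgeConjecture

open NumberField Multiplicative Literature.AlgebraicGeometry.Motives

/-- **Serre 1964: the geometric half implies the barrier fact.** Let `p` be prime, `K₀ = ℚ(ζ_p)`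
with a primitive root `ζ`, `k ⊆ K₀` a subfield with `([K₀ : k], h_k) = 1` and `𝔟 ⊂ 𝓞 k` a
non-principal ideal; let `V` be smooth projective over a number field `K` with embeddings
`φ, ψ : K →+* ℂ`, `V_φ(ℂ) ≠ ∅`.  If at every base point `π₁(V_φ(ℂ), x)` contains an index-`p`
normal copy of `(𝓞 K₀, +)` and `π₁(V_ψ(ℂ), y)` an index-`p` normal copy of `(𝔟 𝓞 K₀, +)`, each
normalised by an element acting as multiplication by `ζ` (Serre, no. 2: `π₁(V_•) = π₁(A_•) ⋊ ℤ/p`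
with `π₁(A_φ) ≅ S`, `π₁(A_ψ) ≅ e_ψ S`), then `Serre1964_conjugateVarieties_notHomeomorphic`
holds: the fundamental groups are not isomorphic (`Serre1964.isEmpty_mulEquiv_numberField`, the
Théorème), hence `V_φ(ℂ) ≄ₜ V_ψ(ℂ)`, hence the `Aut(ℂ)` form
(`serre1964_of_numberField_fundamentalGroup_form`).
[cite: Serre1964Conjugate, nos. 1–2 and Théorème p. 4196] -/
theorem serre1964_of_geometricHalf {p : ℕ} [Fact p.Prime] {K₀ : Type*} [Field K₀]
    [NumberField K₀] [IsCyclotomicExtension {p} ℚ K₀] {ζ : K₀} (hζ : IsPrimitiveRoot ζ p)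
    {k : Type*} [Field k] [NumberField k] [Algebra k K₀]
    {𝔟 : Ideal (𝓞 k)} (h𝔟0 : 𝔟 ≠ ⊥) (h𝔟 : ¬ 𝔟.IsPrincipal)
    (hcop : Nat.Coprime (Module.finrank k K₀) (Fintype.card (ClassGroup (𝓞 k))))
    {K : Type} [Field K] [NumberField K] {n : ℕ} {V : SchemeOver K} (hV : IsSmoothProjective n V)
    (φ ψ : K →+* ℂ) [Nonempty (ComplexPoints ((baseChangeHom φ).obj V))]
    (hφ : ∀ x : ComplexPoints ((baseChangeHom φ).obj V),
      ∃ (ι : Multiplicative (𝓞 K₀) →* FundamentalGroup _ x) (γ₀ : FundamentalGroup _ x),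
        Function.Injective ι ∧ ι.range.Normal ∧ ι.range.index = p ∧
          ∀ s : 𝓞 K₀, γ₀ * ι (ofAdd s) * γ₀⁻¹ = ι (ofAdd (hζ.toInteger * s)))
    (hψ : ∀ y : ComplexPoints ((baseChangeHom ψ).obj V),
      ∃ (ι' : Multiplicative ↥(𝔟.map (algebraMap (𝓞 k) (𝓞 K₀))) →* FundamentalGroup _ y)
        (γ₀' : FundamentalGroup _ y),
        Function.Injective ι' ∧ ι'.range.Normal ∧ ι'.range.index = p ∧
          ∀ b : ↥(𝔟.map (algebraMap (𝓞 k) (𝓞 K₀))),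
            γ₀' * ι' (ofAdd b) * γ₀'⁻¹ = ι' (ofAdd (hζ.toInteger • b))) :
    Serre1964_conjugateVarieties_notHomeomorphic := by
  refine serre1964_of_numberField_fundamentalGroup_form hV φ ψ fun x y ↦ ?_
  obtain ⟨ι, γ₀, hι, hN, hιi, hγ₀⟩ := hφ x
  obtain ⟨ι', γ₀', hι', hN', hι'i, hγ₀'⟩ := hψ y
  exact Serre1964.isEmpty_mulEquiv_numberField hζ h𝔟0 h𝔟 hcop ι hι hιi γ₀ hγ₀ ι' hι' hι'i γ₀' hγ₀'


/-- **Serre 1964: the fact from topological models of the complex points.** Let `V` be smooth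
projective over a number field `K` with embeddings `φ, ψ : K →+* ℂ`, and suppose
`V_φ(ℂ) ≃ₜ (Y₁ × V₁/Λ₁)/G₁` and `V_ψ(ℂ) ≃ₜ (Y₂ × V₂/Λ₂)/G₂` for orbit spaces of free continuous
actions of finite groups of prime order `p` on `Yᵢ × Vᵢ/Λᵢ` — `Yᵢ` simply connected locally
compact Hausdorff ("`Y` … simplement connexe", Lefschetz), `Vᵢ/Λᵢ` tori of simply connected
commutative topological groups by discrete subgroups with `Λ₁ ≅ 𝓞 ℚ(ζ_p)`, `Λ₂ ≅ 𝔟 𝓞 ℚ(ζ_p)`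
(`𝔟 ⊂ 𝓞 k` non-principal, `([ℚ(ζ_p) : k], h_k) = 1`: "`π₁(A_φ)` … libre", "`π₁(A_ψ)` … ne l'est
pas"), a generator acting on the torus through an additive `Mᵢ` restricting to multiplication by
`ζ_p` on the lattice ("`S` opère sur `A`").  Then `Serre1964_conjugateVarieties_notHomeomorphic`
holds (`Serre1964.isEmpty_homeomorph_orbitSpace_of_torusModels` and
`serre1964_of_numberField_form`). [cite: Serre1964Conjugate, nos. 1–2 and Théorème p. 4196] -/
theorem serre1964_of_torusModels
    {p : ℕ} [Fact p.Prime] {K₀ : Type*} [Field K₀] [NumberField K₀]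
    [IsCyclotomicExtension {p} ℚ K₀] {ζ : K₀} (hζ : IsPrimitiveRoot ζ p)
    {k : Type*} [Field k] [NumberField k] [Algebra k K₀]
    {𝔟 : Ideal (𝓞 k)} (h𝔟0 : 𝔟 ≠ ⊥) (h𝔟 : ¬ 𝔟.IsPrincipal)
    (hcop : Nat.Coprime (Module.finrank k K₀) (Fintype.card (ClassGroup (𝓞 k))))
    -- model 1
    {Y₁ V₁ G₁ : Type*} [TopologicalSpace Y₁] [SimplyConnectedSpace Y₁] [LocallyCompactSpace Y₁]
    [T2Space Y₁] [AddCommGroup V₁] [TopologicalSpace V₁] [IsTopologicalAddGroup V₁]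
    [SimplyConnectedSpace V₁] (Λ₁ : AddSubgroup V₁) (hΛ₁ : IsDiscrete (Λ₁ : Set V₁))
    [LocallyCompactSpace (V₁ ⧸ Λ₁)] [T2Space (V₁ ⧸ Λ₁)]
    (M₁ : V₁ →+ V₁) (hM₁c : Continuous M₁) (hM₁ : ∀ v ∈ Λ₁, M₁ v ∈ Λ₁)
    (ε₁ : 𝓞 K₀ ≃+ Λ₁) (hε₁ : ∀ s : 𝓞 K₀, ((ε₁ (hζ.toInteger * s) : Λ₁) : V₁) = M₁ (ε₁ s))
    [Group G₁] [Finite G₁] [MulAction G₁ Y₁] [MulAction G₁ (V₁ ⧸ Λ₁)] [ContinuousConstSMul G₁ Y₁]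
    [ContinuousConstSMul G₁ (V₁ ⧸ Λ₁)] (hG₁ : Nat.card G₁ = p)
    (hfree₁ : ∀ (g : G₁) (z : Y₁ × (V₁ ⧸ Λ₁)), g • z = z → g = 1) (g₁ : G₁)
    (hg₁ : ∀ a : V₁ ⧸ Λ₁, g₁⁻¹ • a =
      Literature.AlgebraicTopology.FundamentalGroup.torusMap Λ₁ M₁ hM₁c hM₁ a)
    -- model 2
    {Y₂ V₂ G₂ : Type*} [TopologicalSpace Y₂] [SimplyConnectedSpace Y₂] [LocallyCompactSpace Y₂]
    [T2Space Y₂] [AddCommGroup V₂] [TopologicalSpace V₂] [IsTopologicalAddGroup V₂]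
    [SimplyConnectedSpace V₂] (Λ₂ : AddSubgroup V₂) (hΛ₂ : IsDiscrete (Λ₂ : Set V₂))
    [LocallyCompactSpace (V₂ ⧸ Λ₂)] [T2Space (V₂ ⧸ Λ₂)]
    (M₂ : V₂ →+ V₂) (hM₂c : Continuous M₂) (hM₂ : ∀ v ∈ Λ₂, M₂ v ∈ Λ₂)
    (ε₂ : ↥(𝔟.map (algebraMap (𝓞 k) (𝓞 K₀))) ≃+ Λ₂)
    (hε₂ : ∀ b : ↥(𝔟.map (algebraMap (𝓞 k) (𝓞 K₀))),
      ((ε₂ (hζ.toInteger • b) : Λ₂) : V₂) = M₂ (ε₂ b))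
    [Group G₂] [Finite G₂] [MulAction G₂ Y₂] [MulAction G₂ (V₂ ⧸ Λ₂)] [ContinuousConstSMul G₂ Y₂]
    [ContinuousConstSMul G₂ (V₂ ⧸ Λ₂)] (hG₂ : Nat.card G₂ = p)
    (hfree₂ : ∀ (g : G₂) (z : Y₂ × (V₂ ⧸ Λ₂)), g • z = z → g = 1) (g₂ : G₂)
    (hg₂ : ∀ a : V₂ ⧸ Λ₂, g₂⁻¹ • a =
      Literature.AlgebraicTopology.FundamentalGroup.torusMap Λ₂ M₂ hM₂c hM₂ a)
    -- the variety and the two homeomorphisms with the models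
    {K : Type} [Field K] [NumberField K] {n : ℕ} {V : SchemeOver K} (hV : IsSmoothProjective n V)
    (φ ψ : K →+* ℂ)
    (eφ : ComplexPoints ((baseChangeHom φ).obj V) ≃ₜ
      MulAction.orbitRel.Quotient G₁ (Y₁ × (V₁ ⧸ Λ₁)))
    (eψ : ComplexPoints ((baseChangeHom ψ).obj V) ≃ₜ
      MulAction.orbitRel.Quotient G₂ (Y₂ × (V₂ ⧸ Λ₂))) :
    Serre1964_conjugateVarieties_notHomeomorphic := by
  refine serre1964_of_numberField_form hV φ ψ ⟨fun f ↦ ?_⟩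
  exact (Serre1964.isEmpty_homeomorph_orbitSpace_of_torusModels hζ h𝔟0 h𝔟 hcop Λ₁ hΛ₁ M₁ hM₁c
    hM₁ ε₁ hε₁ hG₁ hfree₁ g₁ hg₁ Λ₂ hΛ₂ M₂ hM₂c hM₂ ε₂ hε₂ hG₂ hfree₂ g₂ hg₂).false
    (eφ.symm.trans (f.trans eψ))

end Literature.Barriers.HodgeConjecture

end
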